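import Mathlib
import Summits.AnomalousDissipation.AnomalousDissipation.Theorems.SolenoidalFractalHomogenisationLagrangianStepW7SlotPointwise
import Summits.AnomalousDissipation.AnomalousDissipation.Theorems.SolenoidalFractalHomogenisationLagrangianStepW7EngineSpineAC
import Summits.AnomalousDissipation.AnomalousDissipation.Theorems.SolenoidalFractalHomogenisationLagrangianStepW7SlotAC
import HarnessLib

/-!
# K1L_D (stmt-AnomalousDissipation-27980), W7 ENGINE S1b — THE ABSTRACT SLOT STEP
# (one ramped slot, one slow chain with multiplicity `μ`, absolutely continuous data): `E(t₁) ≤ exp(−I_s)·E(t₀)`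
# (helper; `--supports stmt-AnomalousDissipation-27980 --as helper`)

The per-slot contraction of the W7 high-label decay engine (`stub_compactRange` / `stub_largeR` of registry v8; memo
`Lines/onelevel-W7-threemode.md` §2–§3 of planner ad-ideate-p4 g13, scalar spine of planner ad-ideate-p5 g10), ABSTRACT in the chain data and in the
regularity class that the weak-solution mode calculus S1a (prover ad-k1l-cellLawV-w1 g4) delivers — absolutely continuous functions with almost-everywhere
derivatives.  One ramped slot `[t₀, t₁]`, ONE slow Bloch chain `K₀, K_±, K_±±` counted with multiplicity `μ > 0` (the conjugate class contributes the
mirror chain, `μ = 2`), coupling `l(t) = c·A(t)` with a continuous absolutely continuous envelope `0 ≤ A ≤ 1`, `A(t₀) = A(t₁) = 0`, `Ȧ² ≤ 4/(t₁−t₀)²` a.e.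
(the triangle), a viscosity tensor `𝔹` in the window `NearIso 𝔹 lo hi`, `OddSmall 𝔹 β` seen through the numbers `dmin, dtwo, Dmax` attached to the
five wave vectors, dampings `y_j = modalAdjGen 𝔹 K_j w_j`:
* `re_inner_bC`, `l_mul_Ydot_eq_xdotC` — algebra of the cross term `X = Re⟪w₀, bC l K₀ w₊ w₋⟫ = l·Y`, `Y = Re⟪w₀, P₀(w₊ − w₋)⟫`, and `l·Ẏ = xdotC`;
* `pointwise_slot_ineq` — pure real arithmetic: the three-mode form inequality (`threeModeC3_form_le`, hypothesis `hform`) + the dissipation of the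
  remainder of the energy at rate `dmin` + Young on the ramp term `εcȦ·Y` (`|Y| ≤ ‖w₀‖(‖w₊‖+‖w₋‖)`) + the drain floor `q‖w₀‖² ≤ Q̂(w₀)` give
  `−2Q + με·xdot + μεcȦ·Y ≤ −σ·E`, `σ = min(εc²(qA²/2 − 8ε/(dmin T²)), min(dmin, dtwo))` (both signs of the slow coefficient handled);
* **`slot_step`** — with `Φ = E + με·X`: `Φ` is absolutely continuous (`…W7SlotAC`), a.e. `Φ' ≤ −σ(t)·E` (`HasDerivAt.inner`, the chain ODE
  `dW0C/dWpC/dWmC`, `pointwise_slot_ineq`), `7E/8 ≤ Φ ≤ 9E/8` on the slot (`threeModeC3_equiv`, `εc ≤ 1/(4√2)` from (c1),(c2), `dmin ≤ Dmax`),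
  `Φ = E` at both ends, hence by `W7Engine.slot_contraction_ac`
  **`E t₁ ≤ exp(−∫_{t₀}^{t₁} min(σ/(9/8), σ/(7/8)))·E t₀`** — NO prefactor.
Hypotheses are exactly the SHAPES (H1)–(H4) of the assembly plan `HOME/ad-sawtooth-k1loc-p1/W7-ASSEMBLY-PLAN-v1-k1locp1g11.md`; nothing here
mentions the cell carrier (S1a instantiates `w_j, E, Q, A, c` from `IsWeakTensorPassiveVectorOn … (cellField cubatureWord …)`).  No definitions, no
sorry.  W7 assembly owner: prover ad-sawtooth-k1loc-p1 g11.  NOT a proof of the crux / of AD; rung F-D1.A0.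
[cite: BedrossianCotiZelati2017, §2 (hypocoercivity functional with a cross term, Grönwall)] [problem: turb]
-/

set_option linter.dupNamespace false

namespace Summit.AnomalousDissipation.AnomalousDissipation.Theorems.SolenoidalFractalHomogenisation.LagrangianStep.W7Slot

open Set Real MeasureTheory intervalIntegral
open scoped InnerProductSpace
open Literature.Analysis.FluidPDE Literature.Analysis.FluidPDE.Torus
open Literature.Analysis.FunctionSpaces.Torus (freqNormSq)
open Summit.AnomalousDissipation.AnomalousDissipation.Theorems.SolenoidalFractalHomogenisation.LagrangianStep.ThreeMode
open Summit.AnomalousDissipation.AnomalousDissipation.Theorems.SolenoidalFractalHomogenisation.LagrangianStep.W7Engine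


/-! ## §3 The slot step -/

/-- **THE ABSTRACT SLOT STEP** (W7 engine S1b; one ramped slot `[t₀, t₁]`, one slow chain `K_j`, |j| ≤ 2, with multiplicity `μ`).
DATA (all delivered by the weak-solution mode calculus S1a for the cell problem, here abstract): an absolutely continuous energy
`E` with a.e. derivative `−2Q`; the dissipation split `Q ≥ μ Σ_{|j|≤2} Re⟪y_j, w_j⟫ + (dmin/2)(E − μ Σ_{|j|≤2}‖w_j‖²)`
(`y_j = modalAdjGen 𝔹 K_j w_j`, the rest of the energy dissipating at rate `≥ dmin`); absolutely continuous gauged chain modes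
`w₀, w₊, w₋` with the chain ODE `dW0C/dWpC/dWmC` a.e. (coupling `l = c·A(t)`), values `w₊₊, w₋₋`; transversality; the window of
the tensor `𝔹` (`NearIso 𝔹 lo hi`, `OddSmall 𝔹 β`) through the numbers `dmin, dtwo, Dmax`; a continuous, absolutely continuous
envelope `A` vanishing at both ends with `0 ≤ A ≤ 1` and `Ȧ² ≤ 4/(t₁−t₀)²` a.e. (the triangle); the drain floor `q‖w₀‖² ≤ Q̂(w₀)`;
the Young constraints (c1)–(c4) of the three-mode form inequality at `l_peak = c`.
CONCLUSION: `E t₁ ≤ exp(−∫_{t₀}^{t₁} min(σ/(9/8), σ/(7/8)))·E t₀`, `σ(t) = min(εc²(qA(t)²/2 − 8ε/(dmin(t₁−t₀)²)), min(dmin, dtwo))`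
(`threeModeC3_form_le` + remainder + ramp Young ⇒ `Φ̇ ≤ −σE` for `Φ = E + μεX`; `threeModeC3_equiv` ⇒ `7E/8 ≤ Φ ≤ 9E/8`;
`Φ = E` at the slot ends; `slot_contraction_ac`). [cite: BedrossianCotiZelati2017, §2 (hypocoercivity functional)] -/
theorem slot_step {𝔹 : Visc4 (Fin 3)} {lo hi β : ℝ} (h𝔹 : NearIso 𝔹 lo hi) (hlo : 0 ≤ lo) (hhi : 0 ≤ hi)
    (hodd : OddSmall 𝔹 β) (hβ : 0 ≤ β)
    {K0 Kp Km Kpp Kmm : Fin 3 → ℤ} (hKp : Kp ≠ 0) (hKm : Km ≠ 0)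
    {t₀ t₁ : ℝ} (hT : t₀ < t₁)
    {w0 wp wm wpp wmm : ℝ → (EuclideanSpace ℂ (Fin 3))} {E Q A Ad : ℝ → ℝ} {μ c ε q dmin dtwo Dmax : ℝ}
    (hμ : 0 < μ) (hc : 0 ≤ c) (hε : 0 ≤ ε) (hdmin : 0 < dmin) (hdtwo : 0 ≤ dtwo)
    -- the window numbers against the five wave vectors
    (hdp : dmin ≤ 4 * Real.pi ^ 2 * lo * freqNormSq Kp) (hdm : dmin ≤ 4 * Real.pi ^ 2 * lo * freqNormSq Km)
    (hdpp : dtwo ≤ 4 * Real.pi ^ 2 * lo * freqNormSq Kpp) (hdmm : dtwo ≤ 4 * Real.pi ^ 2 * lo * freqNormSq Kmm)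
    (hDp : 4 * Real.pi ^ 2 * (hi + β / 2) * freqNormSq Kp ≤ Dmax) (hDm : 4 * Real.pi ^ 2 * (hi + β / 2) * freqNormSq Km ≤ Dmax)
    (hdD : dmin ≤ Dmax)
    -- the Young constraints at `l_peak = c` (`D0 := 4π²(hi+β/2)|K₀|²`, `d₀ := 4π² lo |K₀|²`)
    (c1 : 8 * ε * c ^ 2 ≤ dmin) (c2 : 4 * ε * Dmax ^ 2 ≤ dmin) (c3 : ε * c ^ 2 ≤ dtwo)
    (c4 : 32 * ε ^ 2 * c ^ 2 * (4 * Real.pi ^ 2 * (hi + β / 2) * freqNormSq K0) ^ 2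
      ≤ (4 * Real.pi ^ 2 * lo * freqNormSq K0) * dmin)
    -- the envelope
    (hAc : Continuous A) (hA01 : ∀ t ∈ Icc t₀ t₁, 0 ≤ A t ∧ A t ≤ 1) (hA0 : A t₀ = 0) (hA1 : A t₁ = 0)
    (hAac : AbsolutelyContinuousOnInterval A t₀ t₁) (hAd : ∀ᵐ t, t ∈ uIcc t₀ t₁ → HasDerivAt A (Ad t) t)
    (hAd2 : ∀ᵐ t, t ∈ uIcc t₀ t₁ → Ad t ^ 2 ≤ 4 / (t₁ - t₀) ^ 2)
    -- the modes: transversality, drain floor, absolute continuity, the chain ODE a.e.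
    (hT0 : ∀ t, kdot K0 (w0 t) = 0) (hTp : ∀ t, kdot Kp (wp t) = 0) (hTm : ∀ t, kdot Km (wm t) = 0)
    (hTpp : ∀ t, kdot Kpp (wpp t) = 0) (hTmm : ∀ t, kdot Kmm (wmm t) = 0)
    (hqw : ∀ t, q * ‖w0 t‖ ^ 2 ≤ ‖transversalProj Kp (w0 t)‖ ^ 2 + ‖transversalProj Km (w0 t)‖ ^ 2)
    (h0ac : AbsolutelyContinuousOnInterval w0 t₀ t₁) (hpac : AbsolutelyContinuousOnInterval wp t₀ t₁)
    (hmac : AbsolutelyContinuousOnInterval wm t₀ t₁)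
    (hd0 : ∀ᵐ t, t ∈ uIcc t₀ t₁ → HasDerivAt w0 (dW0C (c * A t) K0 (wp t) (wm t) (modalAdjGen 𝔹 K0 (w0 t))) t)
    (hdp' : ∀ᵐ t, t ∈ uIcc t₀ t₁ → HasDerivAt wp (dWpC (c * A t) Kp (w0 t) (wpp t) (modalAdjGen 𝔹 Kp (wp t))) t)
    (hdm' : ∀ᵐ t, t ∈ uIcc t₀ t₁ → HasDerivAt wm (dWmC (c * A t) Km (w0 t) (wmm t) (modalAdjGen 𝔹 Km (wm t))) t)
    -- the energy and the dissipation split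
    (hEac : AbsolutelyContinuousOnInterval E t₀ t₁) (hEd : ∀ᵐ t, t ∈ uIcc t₀ t₁ → HasDerivAt E (-2 * Q t) t)
    (hE5 : ∀ t ∈ Icc t₀ t₁, μ * (‖w0 t‖ ^ 2 + ‖wp t‖ ^ 2 + ‖wm t‖ ^ 2 + ‖wpp t‖ ^ 2 + ‖wmm t‖ ^ 2) ≤ E t)
    (hQ : ∀ᵐ t, t ∈ uIcc t₀ t₁ →
      μ * ((⟪modalAdjGen 𝔹 K0 (w0 t), w0 t⟫_ℂ).re + (⟪modalAdjGen 𝔹 Kp (wp t), wp t⟫_ℂ).re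
          + (⟪modalAdjGen 𝔹 Km (wm t), wm t⟫_ℂ).re + (⟪modalAdjGen 𝔹 Kpp (wpp t), wpp t⟫_ℂ).re
          + (⟪modalAdjGen 𝔹 Kmm (wmm t), wmm t⟫_ℂ).re)
        + (dmin / 2) * (E t - μ * (‖w0 t‖ ^ 2 + ‖wp t‖ ^ 2 + ‖wm t‖ ^ 2 + ‖wpp t‖ ^ 2 + ‖wmm t‖ ^ 2)) ≤ Q t) :
    E t₁ ≤ Real.exp (-∫ s in t₀..t₁,
        min ((min (ε * c ^ 2 * (q * A s ^ 2 / 2 - 8 * ε / (dmin * (t₁ - t₀) ^ 2))) (min dmin dtwo)) / (9 / 8))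
            ((min (ε * c ^ 2 * (q * A s ^ 2 / 2 - 8 * ε / (dmin * (t₁ - t₀) ^ 2))) (min dmin dtwo)) / (7 / 8))) * E t₀ := by
  have ht : t₀ ≤ t₁ := hT.le
  have hIcc : uIcc t₀ t₁ = Icc t₀ t₁ := uIcc_of_le ht
  have hTpos : 0 < t₁ - t₀ := sub_pos.2 hT
  -- abbreviations
  set P0 : (EuclideanSpace ℂ (Fin 3)) →L[ℂ] (EuclideanSpace ℂ (Fin 3)) := transversalProj K0 with hP0
  set Y : ℝ → ℝ := fun t => (⟪w0 t, P0 (wp t - wm t)⟫_ℂ).re with hY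
  set X : ℝ → ℝ := fun t => (c * A t) * Y t with hX
  set Φ : ℝ → ℝ := fun t => E t + μ * (ε * X t) with hΦ
  set σ : ℝ → ℝ := fun s => min (ε * c ^ 2 * (q * A s ^ 2 / 2 - 8 * ε / (dmin * (t₁ - t₀) ^ 2))) (min dmin dtwo) with hσ
  have hXbC : ∀ t, X t = (⟪w0 t, bC (c * A t) K0 (wp t) (wm t)⟫_ℂ).re := fun t => by
    rw [hX, hY, re_inner_bC]
  -- (0) the window facts at each instant
  have hd0c : ∀ t, (4 * Real.pi ^ 2 * lo * freqNormSq K0) * ‖w0 t‖ ^ 2 ≤ (⟪modalAdjGen 𝔹 K0 (w0 t), w0 t⟫_ℂ).re :=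
    fun t => coercivity_modalAdjGen h𝔹 K0 (w0 t) (hT0 t)
  have hdpc : ∀ t, dmin * ‖wp t‖ ^ 2 ≤ (⟪modalAdjGen 𝔹 Kp (wp t), wp t⟫_ℂ).re := fun t =>
    (mul_le_mul_of_nonneg_right hdp (sq_nonneg _)).trans (coercivity_modalAdjGen h𝔹 Kp (wp t) (hTp t))
  have hdmc : ∀ t, dmin * ‖wm t‖ ^ 2 ≤ (⟪modalAdjGen 𝔹 Km (wm t), wm t⟫_ℂ).re := fun t =>
    (mul_le_mul_of_nonneg_right hdm (sq_nonneg _)).trans (coercivity_modalAdjGen h𝔹 Km (wm t) (hTm t))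
  have hdppc : ∀ t, dtwo * ‖wpp t‖ ^ 2 ≤ (⟪modalAdjGen 𝔹 Kpp (wpp t), wpp t⟫_ℂ).re := fun t =>
    (mul_le_mul_of_nonneg_right hdpp (sq_nonneg _)).trans (coercivity_modalAdjGen h𝔹 Kpp (wpp t) (hTpp t))
  have hdmmc : ∀ t, dtwo * ‖wmm t‖ ^ 2 ≤ (⟪modalAdjGen 𝔹 Kmm (wmm t), wmm t⟫_ℂ).re := fun t =>
    (mul_le_mul_of_nonneg_right hdmm (sq_nonneg _)).trans (coercivity_modalAdjGen h𝔹 Kmm (wmm t) (hTmm t))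
  have hYp : ∀ t, ‖modalAdjGen 𝔹 Kp (wp t)‖ ≤ Dmax * ‖wp t‖ := fun t =>
    (norm_modalAdjGen_le h𝔹 hlo hhi hodd hβ Kp (wp t) (hTp t)).trans (mul_le_mul_of_nonneg_right hDp (norm_nonneg _))
  have hYm : ∀ t, ‖modalAdjGen 𝔹 Km (wm t)‖ ≤ Dmax * ‖wm t‖ := fun t =>
    (norm_modalAdjGen_le h𝔹 hlo hhi hodd hβ Km (wm t) (hTm t)).trans (mul_le_mul_of_nonneg_right hDm (norm_nonneg _))
  have hY0 : ∀ t, ‖modalAdjGen 𝔹 K0 (w0 t)‖ ≤ (4 * Real.pi ^ 2 * (hi + β / 2) * freqNormSq K0) * ‖w0 t‖ := fun t =>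
    norm_modalAdjGen_le h𝔹 hlo hhi hodd hβ K0 (w0 t) (hT0 t)
  have hD0nn : 0 ≤ 4 * Real.pi ^ 2 * (hi + β / 2) * freqNormSq K0 := by
    have := Literature.Analysis.FunctionSpaces.Torus.freqNormSq_nonneg K0
    positivity
  have hd0nn : 0 ≤ 4 * Real.pi ^ 2 * lo * freqNormSq K0 := by
    have := Literature.Analysis.FunctionSpaces.Torus.freqNormSq_nonneg K0
    positivity
  -- (1) the pointwise form inequality at each instant of the slot (`l = c·A t ≤ c`)
  have hform : ∀ t ∈ Icc t₀ t₁,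
      -2 * ((⟪modalAdjGen 𝔹 K0 (w0 t), w0 t⟫_ℂ).re + (⟪modalAdjGen 𝔹 Kp (wp t), wp t⟫_ℂ).re
          + (⟪modalAdjGen 𝔹 Km (wm t), wm t⟫_ℂ).re + (⟪modalAdjGen 𝔹 Kpp (wpp t), wpp t⟫_ℂ).re
          + (⟪modalAdjGen 𝔹 Kmm (wmm t), wmm t⟫_ℂ).re)
        + ε * xdotC (c * A t) K0 Kp Km (w0 t) (wp t) (wm t) (wpp t) (wmm t)
            (modalAdjGen 𝔹 K0 (w0 t)) (modalAdjGen 𝔹 Kp (wp t)) (modalAdjGen 𝔹 Km (wm t))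
      ≤ -(ε * (c * A t) ^ 2 / 2) * (‖transversalProj Kp (w0 t)‖ ^ 2 + ‖transversalProj Km (w0 t)‖ ^ 2)
        - (5 * dmin / 4) * (‖wp t‖ ^ 2 + ‖wm t‖ ^ 2) - dtwo * (‖wpp t‖ ^ 2 + ‖wmm t‖ ^ 2)
        - (7 * (4 * Real.pi ^ 2 * lo * freqNormSq K0) / 4) * ‖w0 t‖ ^ 2 := by
    intro t htI
    obtain ⟨hA0t, hA1t⟩ := hA01 t htI
    have hl : 0 ≤ c * A t := mul_nonneg hc hA0t
    have hA2 : (c * A t) ^ 2 ≤ c ^ 2 := by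
      rw [mul_pow]; nlinarith [sq_nonneg c, mul_le_one₀ hA1t hA0t hA1t]
    have c1' : 8 * ε * (c * A t) ^ 2 ≤ dmin := by
      have h := mul_le_mul_of_nonneg_left hA2 (by positivity : 0 ≤ 8 * ε)
      linarith
    have c3' : ε * (c * A t) ^ 2 ≤ dtwo := by
      have h := mul_le_mul_of_nonneg_left hA2 hε
      linarith
    have c4' : 32 * ε ^ 2 * (c * A t) ^ 2 * (4 * Real.pi ^ 2 * (hi + β / 2) * freqNormSq K0) ^ 2
        ≤ (4 * Real.pi ^ 2 * lo * freqNormSq K0) * dmin := by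
      have h := mul_le_mul_of_nonneg_left hA2
        (by positivity : 0 ≤ 32 * ε ^ 2 * (4 * Real.pi ^ 2 * (hi + β / 2) * freqNormSq K0) ^ 2)
      have e1 : 32 * ε ^ 2 * (4 * Real.pi ^ 2 * (hi + β / 2) * freqNormSq K0) ^ 2 * (c * A t) ^ 2
          = 32 * ε ^ 2 * (c * A t) ^ 2 * (4 * Real.pi ^ 2 * (hi + β / 2) * freqNormSq K0) ^ 2 := by ring
      have e2 : 32 * ε ^ 2 * (4 * Real.pi ^ 2 * (hi + β / 2) * freqNormSq K0) ^ 2 * c ^ 2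
          = 32 * ε ^ 2 * c ^ 2 * (4 * Real.pi ^ 2 * (hi + β / 2) * freqNormSq K0) ^ 2 := by ring
      rw [e1, e2] at h
      exact h.trans c4
    exact threeModeC3_form_le (c * A t) ε (4 * Real.pi ^ 2 * lo * freqNormSq K0) dmin dmin dtwo dtwo dmin dtwo Dmax
      (4 * Real.pi ^ 2 * (hi + β / 2) * freqNormSq K0) K0 Kp Km (w0 t) (wp t) (wm t) (wpp t) (wmm t)
      (modalAdjGen 𝔹 K0 (w0 t)) (modalAdjGen 𝔹 Kp (wp t)) (modalAdjGen 𝔹 Km (wm t))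
      (modalAdjGen 𝔹 Kpp (wpp t)) (modalAdjGen 𝔹 Kmm (wmm t))
      (hT0 t) (kdot_modalAdjGen_eq_zero 𝔹 hKp _) (kdot_modalAdjGen_eq_zero 𝔹 hKm _) hl hε hd0nn hdmin.le hD0nn
      (hd0c t) (hdpc t) (hdmc t) (hdppc t) (hdmmc t) (hYp t) (hYm t) (hY0 t) le_rfl le_rfl le_rfl le_rfl c1' c2 c3' c4'
  -- (2) the a.e. derivative of `Φ` and the inequality `Φ' ≤ −σ E`
  have hderiv : ∀ᵐ t, t ∈ uIcc t₀ t₁ → HasDerivAt Φ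
      (-2 * Q t + μ * (ε * xdotC (c * A t) K0 Kp Km (w0 t) (wp t) (wm t) (wpp t) (wmm t)
            (modalAdjGen 𝔹 K0 (w0 t)) (modalAdjGen 𝔹 Kp (wp t)) (modalAdjGen 𝔹 Km (wm t)))
        + μ * (ε * (c * Ad t) * Y t)) t ∧
      (-2 * Q t + μ * (ε * xdotC (c * A t) K0 Kp Km (w0 t) (wp t) (wm t) (wpp t) (wmm t)
            (modalAdjGen 𝔹 K0 (w0 t)) (modalAdjGen 𝔹 Kp (wp t)) (modalAdjGen 𝔹 Km (wm t)))
        + μ * (ε * (c * Ad t) * Y t) ≤ -σ t * E t) := by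
    filter_upwards [hd0, hdp', hdm', hAd, hAd2, hEd, hQ] with t h0 hp hm hA hA2 hE hQt htI
    have htI' : t ∈ Icc t₀ t₁ := by rwa [hIcc] at htI
    specialize h0 htI; specialize hp htI; specialize hm htI; specialize hA htI; specialize hA2 htI
    specialize hE htI; specialize hQt htI
    -- derivative of `Y`
    have hg : HasDerivAt (fun s => P0 (wp s - wm s))
        (P0 (dWpC (c * A t) Kp (w0 t) (wpp t) (modalAdjGen 𝔹 Kp (wp t))
              - dWmC (c * A t) Km (w0 t) (wmm t) (modalAdjGen 𝔹 Km (wm t)))) t :=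
      (P0.restrictScalars ℝ).hasFDerivAt.comp_hasDerivAt t (hp.sub hm)
    have hinner := h0.inner ℂ hg
    have hYd : HasDerivAt Y ((⟪w0 t, P0 (dWpC (c * A t) Kp (w0 t) (wpp t) (modalAdjGen 𝔹 Kp (wp t))
              - dWmC (c * A t) Km (w0 t) (wmm t) (modalAdjGen 𝔹 Km (wm t)))⟫_ℂ
            + ⟪dW0C (c * A t) K0 (wp t) (wm t) (modalAdjGen 𝔹 K0 (w0 t)), P0 (wp t - wm t)⟫_ℂ).re) t := by
      have h := Complex.reCLM.hasFDerivAt.comp_hasDerivAt t hinner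
      simpa only [Function.comp_def, Complex.reCLM_apply] using h
    have hXd : HasDerivAt X (c * Ad t * Y t + c * A t *
        ((⟪w0 t, P0 (dWpC (c * A t) Kp (w0 t) (wpp t) (modalAdjGen 𝔹 Kp (wp t))
              - dWmC (c * A t) Km (w0 t) (wmm t) (modalAdjGen 𝔹 Km (wm t)))⟫_ℂ
            + ⟪dW0C (c * A t) K0 (wp t) (wm t) (modalAdjGen 𝔹 K0 (w0 t)), P0 (wp t - wm t)⟫_ℂ).re)) t := by
      exact (hA.const_mul c).mul hYd
    have hxdot : c * A t *
        ((⟪w0 t, P0 (dWpC (c * A t) Kp (w0 t) (wpp t) (modalAdjGen 𝔹 Kp (wp t))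
              - dWmC (c * A t) Km (w0 t) (wmm t) (modalAdjGen 𝔹 Km (wm t)))⟫_ℂ
            + ⟪dW0C (c * A t) K0 (wp t) (wm t) (modalAdjGen 𝔹 K0 (w0 t)), P0 (wp t - wm t)⟫_ℂ).re)
        = xdotC (c * A t) K0 Kp Km (w0 t) (wp t) (wm t) (wpp t) (wmm t)
            (modalAdjGen 𝔹 K0 (w0 t)) (modalAdjGen 𝔹 Kp (wp t)) (modalAdjGen 𝔹 Km (wm t)) := by
      rw [Complex.add_re]
      exact l_mul_Ydot_eq_xdotC (c * A t) K0 Kp Km (w0 t) (wp t) (wm t) (wpp t) (wmm t) _ _ _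
    have hΦd : HasDerivAt Φ (-2 * Q t + μ * (ε * (c * Ad t * Y t + xdotC (c * A t) K0 Kp Km (w0 t) (wp t) (wm t) (wpp t) (wmm t)
            (modalAdjGen 𝔹 K0 (w0 t)) (modalAdjGen 𝔹 Kp (wp t)) (modalAdjGen 𝔹 Km (wm t))))) t := by
      have h := hE.add ((hXd.const_mul ε).const_mul μ)
      rw [hxdot] at h
      exact h
    refine ⟨?_, ?_⟩
    · convert hΦd using 1; ring
    · -- the pointwise inequality
      have key := pointwise_slot_ineq (A := A t) (Ad := Ad t) (T := t₁ - t₀) (d0 := 4 * Real.pi ^ 2 * lo * freqNormSq K0)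
        hμ hε hc hdmin hdtwo hd0nn hTpos (hform t htI') (hqw t)
        (rampC3_pairing_le K0 (w0 t) (wp t) (wm t)) hA2 (hE5 t htI') hQt
      exact key
  -- (3) sandwich `7E/8 ≤ Φ ≤ 9E/8` on the slot, and `Φ = E` at the ends
  have hεc : ε * c * Real.sqrt 2 / 2 ≤ 1 / 8 := by
    have hDmax : 0 < Dmax := lt_of_lt_of_le hdmin hdD
    have h32 : 32 * (ε * c) ^ 2 ≤ 1 := by
      have h1 : (8 * ε * c ^ 2) * (4 * ε * Dmax ^ 2) ≤ dmin * dmin :=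
        mul_le_mul c1 c2 (by positivity) hdmin.le
      have h2 : dmin * dmin ≤ Dmax * Dmax := mul_le_mul hdD hdD hdmin.le hDmax.le
      have e : (8 * ε * c ^ 2) * (4 * ε * Dmax ^ 2) = (32 * (ε * c) ^ 2) * Dmax ^ 2 := by ring
      have h3 : (32 * (ε * c) ^ 2) * Dmax ^ 2 ≤ 1 * Dmax ^ 2 := by
        rw [← e]; calc _ ≤ dmin * dmin := h1
          _ ≤ Dmax * Dmax := h2
          _ = 1 * Dmax ^ 2 := by ring
      exact le_of_mul_le_mul_right h3 (by positivity : (0:ℝ) < Dmax ^ 2)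
    have hs : Real.sqrt 2 ^ 2 = 2 := Real.sq_sqrt (by norm_num)
    have hnn : 0 ≤ ε * c * Real.sqrt 2 / 2 := by positivity
    have hx : (ε * c * Real.sqrt 2 / 2) ^ 2 ≤ (1 / 8) ^ 2 := by
      have e : (ε * c * Real.sqrt 2 / 2) ^ 2 = (ε * c) ^ 2 * (Real.sqrt 2 ^ 2) / 4 := by ring
      rw [e, hs]
      linarith
    exact (pow_le_pow_iff_left₀ hnn (by norm_num) two_ne_zero).1 hx
  have hsand : ∀ t ∈ Icc t₀ t₁, |μ * (ε * X t)| ≤ E t / 8 := by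
    intro t htI
    obtain ⟨hA0t, hA1t⟩ := hA01 t htI
    have hl : 0 ≤ c * A t := mul_nonneg hc hA0t
    have h3 := threeModeC3_equiv (c * A t) ε K0 (w0 t) (wp t) (wm t) hl hε
    rw [← hXbC t] at h3
    have hE3 : ‖w0 t‖ ^ 2 + ‖wp t‖ ^ 2 + ‖wm t‖ ^ 2 ≤
        ‖w0 t‖ ^ 2 + ‖wp t‖ ^ 2 + ‖wm t‖ ^ 2 + ‖wpp t‖ ^ 2 + ‖wmm t‖ ^ 2 := by linarith [sq_nonneg ‖wpp t‖, sq_nonneg ‖wmm t‖]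
    have hE5t := hE5 t htI
    have hcA : ε * (c * A t) * Real.sqrt 2 ≤ ε * c * Real.sqrt 2 := by
      have h1 : c * A t ≤ c := mul_le_of_le_one_right hc hA1t
      have h2 : ε * (c * A t) ≤ ε * c := mul_le_mul_of_nonneg_left h1 hε
      exact mul_le_mul_of_nonneg_right h2 (Real.sqrt_nonneg 2)
    rw [abs_mul, abs_of_pos hμ]
    have h4 : |ε * X t| ≤ ε * c * Real.sqrt 2 / 2 * (‖w0 t‖ ^ 2 + ‖wp t‖ ^ 2 + ‖wm t‖ ^ 2 + ‖wpp t‖ ^ 2 + ‖wmm t‖ ^ 2) := by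
      have hpos : 0 ≤ ‖w0 t‖ ^ 2 + ‖wp t‖ ^ 2 + ‖wm t‖ ^ 2 := by positivity
      have hk : 0 ≤ ε * c * Real.sqrt 2 := by positivity
      have s1 : ε * (c * A t) * Real.sqrt 2 * (‖w0 t‖ ^ 2 + ‖wp t‖ ^ 2 + ‖wm t‖ ^ 2)
          ≤ ε * c * Real.sqrt 2 * (‖w0 t‖ ^ 2 + ‖wp t‖ ^ 2 + ‖wm t‖ ^ 2) := mul_le_mul_of_nonneg_right hcA hpos
      have s2 : ε * c * Real.sqrt 2 * (‖w0 t‖ ^ 2 + ‖wp t‖ ^ 2 + ‖wm t‖ ^ 2)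
          ≤ ε * c * Real.sqrt 2 * (‖w0 t‖ ^ 2 + ‖wp t‖ ^ 2 + ‖wm t‖ ^ 2 + ‖wpp t‖ ^ 2 + ‖wmm t‖ ^ 2) :=
        mul_le_mul_of_nonneg_left hE3 hk
      linarith [h3, s1, s2]
    calc μ * |ε * X t| ≤ μ * (ε * c * Real.sqrt 2 / 2 * (‖w0 t‖ ^ 2 + ‖wp t‖ ^ 2 + ‖wm t‖ ^ 2 + ‖wpp t‖ ^ 2 + ‖wmm t‖ ^ 2)) :=
          mul_le_mul_of_nonneg_left h4 hμ.le
      _ = ε * c * Real.sqrt 2 / 2 * (μ * (‖w0 t‖ ^ 2 + ‖wp t‖ ^ 2 + ‖wm t‖ ^ 2 + ‖wpp t‖ ^ 2 + ‖wmm t‖ ^ 2)) := by ring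
      _ ≤ 1 / 8 * E t := mul_le_mul hεc hE5t (by positivity) (by norm_num)
      _ = E t / 8 := by ring
  have hlo' : ∀ t ∈ Icc t₀ t₁, 7 / 8 * E t ≤ Φ t := fun t htI => by
    have h := hsand t htI; rw [hΦ]; have := neg_abs_le (μ * (ε * X t)); linarith
  have hhi' : ∀ t ∈ Icc t₀ t₁, Φ t ≤ 9 / 8 * E t := fun t htI => by
    have h := hsand t htI; rw [hΦ]; have := le_abs_self (μ * (ε * X t)); linarith
  have hΦ0 : Φ t₀ = E t₀ := by simp [hΦ, hX, hA0]
  have hΦ1 : Φ t₁ = E t₁ := by simp [hΦ, hX, hA1]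
  -- (4) absolute continuity of `Φ`
  have hYac : AbsolutelyContinuousOnInterval Y t₀ t₁ := by
    have hg : AbsolutelyContinuousOnInterval (fun s => P0 (wp s - wm s)) t₀ t₁ :=
      (hpac.fun_sub hmac).clm_comp (P0.restrictScalars ℝ)
    have h := h0ac.re_inner (𝕜 := ℂ) hg
    simpa only [hY, RCLike.re_to_complex] using h
  have hXac : AbsolutelyContinuousOnInterval X t₀ t₁ := by
    have h := (hAac.const_mul c).fun_mul hYac
    simpa only [hX] using h
  have hΦac : AbsolutelyContinuousOnInterval Φ t₀ t₁ := by
    have h := hEac.fun_add ((hXac.const_mul ε).const_mul μ)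
    simpa only [hΦ] using h
  -- (5) the contraction
  have hσc : Continuous σ := by
    rw [hσ]
    exact ((continuous_const.mul ((continuous_const.mul ((hAc.pow 2))).div_const _ |>.sub continuous_const))).min
      continuous_const
  have hΦd' : ∀ᵐ t, t ∈ uIcc t₀ t₁ → HasDerivAt Φ
      (-2 * Q t + μ * (ε * xdotC (c * A t) K0 Kp Km (w0 t) (wp t) (wm t) (wpp t) (wmm t)
            (modalAdjGen 𝔹 K0 (w0 t)) (modalAdjGen 𝔹 Kp (wp t)) (modalAdjGen 𝔹 Km (wm t)))
        + μ * (ε * (c * Ad t) * Y t)) t :=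
    hderiv.mono fun t ht htI => (ht htI).1
  have hineq : ∀ᵐ t, t ∈ uIcc t₀ t₁ →
      (-2 * Q t + μ * (ε * xdotC (c * A t) K0 Kp Km (w0 t) (wp t) (wm t) (wpp t) (wmm t)
            (modalAdjGen 𝔹 K0 (w0 t)) (modalAdjGen 𝔹 Kp (wp t)) (modalAdjGen 𝔹 Km (wm t)))
        + μ * (ε * (c * Ad t) * Y t)) ≤ -σ t * E t :=
    hderiv.mono fun t ht htI => (ht htI).2
  have key := slot_contraction_ac (c₁ := 7 / 8) (c₂ := 9 / 8) ht (by norm_num) (by norm_num) hΦac hΦd' hσc hineq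
    hlo' hhi' hΦ0 hΦ1
  simpa [hσ] using key

end Summit.AnomalousDissipation.AnomalousDissipation.Theorems.SolenoidalFractalHomogenisation.LagrangianStep.W7Slot
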